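import Summits.Ventures.CertifiedArithmetic.Expansions.CompressKinkFamily
import Mathlib.Tactic.Linarith
import Mathlib.Tactic.Positivity
import Mathlib.Tactic.Ring
import Mathlib.Tactic.NormNum

/-!
# COMPRESS can need any number of passes (new work)

New work of the certified-arithmetic venture (ENGINES group: shared numerical engines serving
client cells; rigour lives in the verifiers; every published number belongs to a client cell's
ledger, not to the engines group).  NOT a published theorem: Shewchuk [Shewchuk1997, §2.7] proves
Theorem 23 about ONE pass of COMPRESS and says nothing about iterating it; the tree knows inputs
needing two passes at every precision (`CompressNotIdempotent.lean`) and three at `p = 2`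
(`CompressThreePasses.lean`).  Here, with the kink family of `CompressKinkFamily.lean`
(`p = 3`, IEEE ties-to-even `roundTiesEven 3 emin`, `emin ≤ 0`):

* `fam3_passes`, `fam3_pass_changes`: on `fam3 k` (a nonoverlapping expansion of `2k + 4` three-bit
  floats) COMPRESS changes its input in EACH of the first `k + 1` passes and is fixed afterwards;
* `isExpansion_fam3`, `isFloat_of_mem_fam3`, `length_fam3`: the inputs are legitimate;
* `compress_passes_unbounded`: the summary — `passes(fam3 k) = k + 1 = n/2 − 1` for `n = 2k + 4`
  components, so **no bound on the number of COMPRESS passes needed to reach the fixed point holds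
  uniformly in the length of the expansion** (and `passes ≥ n/2 − 1` is attained for every even
  `n ≥ 4`).
-/

namespace Summit.Ventures.CertifiedArithmetic.Expansions

open Literature.ComputerArithmetic.JeannerodRump2018
open Literature.ComputerArithmetic.BoldoJeannerodMelquiondMuller2023 hiding twoSum twoSum_fst
open Literature.ComputerArithmetic.Shewchuk1997

variable {emin : ℤ}

/-! ### Counting the passes -/

section passes
variable (he : emin ≤ 0)
include he

/-- `i` passes move the kink `i` blocks down. [cite: Shewchuk1997, §2.7 p. 332 (COMPRESS)] -/
theorem compress_iterate_state3 : ∀ (i m n : ℕ),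
    (compress (roundTiesEven 3 emin))^[i] (state3 (m + i) n) = state3 m (n + i)
  | 0, m, n => by simp
  | i + 1, m, n => by
    rw [Function.iterate_succ_apply, show m + (i + 1) = (m + i) + 1 by ring,
      compress_state3_succ he, compress_iterate_state3 i m (n + 1)]
    ring_nf

/-- **COMPRESS needs exactly `k + 1` passes on `fam3 k`**: after `k` passes the kink is at the
bottom, pass `k + 1` still changes the expansion, and from then on it is fixed.
[cite: Shewchuk1997, §2.7 p. 332 (COMPRESS)] -/
theorem fam3_passes (k : ℕ) :
    (compress (roundTiesEven 3 emin))^[k] (fam3 k) = state3 0 k ∧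
      (compress (roundTiesEven 3 emin))^[k + 1] (fam3 k) = final3 k ∧
      (compress (roundTiesEven 3 emin))^[k + 2] (fam3 k) = final3 k ∧
      (compress (roundTiesEven 3 emin))^[k + 1] (fam3 k) ≠
        (compress (roundTiesEven 3 emin))^[k] (fam3 k) := by
  have hk : (compress (roundTiesEven 3 emin))^[k] (fam3 k) = state3 0 k := by
    simpa [fam3] using compress_iterate_state3 he k 0 0
  have hk1 : (compress (roundTiesEven 3 emin))^[k + 1] (fam3 k) = final3 k := by
    rw [Function.iterate_succ_apply', hk, compress_state3_zero he]
  have hk2 : (compress (roundTiesEven 3 emin))^[k + 2] (fam3 k) = final3 k := by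
    rw [show k + 2 = (k + 1) + 1 by ring, Function.iterate_succ_apply', hk1, compress_final3 he]
  refine ⟨hk, hk1, hk2, ?_⟩
  rw [hk1, hk]
  simp [final3, state3, pairs3, kink3]

/-- Hence EVERY one of the first `k + 1` passes changes the expansion (a pass that changed nothing
would freeze all later ones). [cite: Shewchuk1997, §2.7 p. 332 (COMPRESS)] -/
theorem fam3_pass_changes (k j : ℕ) (hj : j ≤ k) :
    (compress (roundTiesEven 3 emin))^[j + 1] (fam3 k) ≠
      (compress (roundTiesEven 3 emin))^[j] (fam3 k) := by
  intro h
  rw [Function.iterate_succ_apply'] at h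
  have frozen : ∀ t : ℕ, (compress (roundTiesEven 3 emin))^[j + t] (fam3 k) =
      (compress (roundTiesEven 3 emin))^[j] (fam3 k) := by
    intro t
    induction t with
    | zero => rfl
    | succ t ih => rw [← add_assoc, Function.iterate_succ_apply', ih, h]
  obtain ⟨-, -, -, hne⟩ := fam3_passes he k
  apply hne
  obtain ⟨d, rfl⟩ := Nat.exists_eq_add_of_le hj
  rw [show j + d + 1 = j + (d + 1) by ring, frozen (d + 1), frozen d]

end passes

/-! ### `fam3 k` is a nonoverlapping expansion of 3-bit floats -/

/-- Every component of a pair block lies below `2^(9m)`. -/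
theorem abs_lt_of_mem_pairs3 : ∀ (m : ℕ) (x : ℚ), x ∈ pairs3 m → |x| < (2 : ℚ) ^ (9 * (m : ℤ))
  | 0, x, hx => by simp [pairs3] at hx
  | m + 1, x, hx => by
    have hpow : (2 : ℚ) ^ (9 * (m : ℤ)) * 2 ^ (9 : ℕ) = 2 ^ (9 * ((m + 1 : ℕ) : ℤ)) := by
      rw [show (9 * ((m + 1 : ℕ) : ℤ)) = 9 * (m : ℤ) + (9 : ℕ) by push_cast; ring,
        zpow_add₀ (by norm_num : (2 : ℚ) ≠ 0), zpow_natCast]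
    have h2 : (0 : ℚ) < 2 ^ (9 * (m : ℤ)) := zpow_pos (by norm_num) _
    rw [pairs3, List.mem_append] at hx
    rw [← hpow]
    rcases hx with hx | hx
    · have := abs_lt_of_mem_pairs3 m x hx
      calc |x| < (2 : ℚ) ^ (9 * (m : ℤ)) * 1 := by simpa using this
        _ ≤ _ := by gcongr; norm_num
    · simp only [sc_cons, sc_nil, List.mem_cons, List.not_mem_nil, or_false] at hx
      rcases hx with rfl | rfl <;> rw [abs_mul, abs_of_pos h2, mul_comm] <;> gcongr <;> norm_num

/-- The pair blocks form a nonoverlapping expansion. [cite: Shewchuk1997, §2.1 (nonoverlapping)] -/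
theorem isExpansion_pairs3 : ∀ m : ℕ, IsExpansion 1 (pairs3 m)
  | 0 => isExpansion_nil 1
  | m + 1 => by
    have h2 : (0 : ℚ) < 2 ^ (9 * (m : ℤ)) := zpow_pos (by norm_num) _
    rw [pairs3, IsExpansion, List.pairwise_append]
    refine ⟨isExpansion_pairs3 m, ?_, ?_⟩
    · simp only [sc_cons, sc_nil]
      refine List.Pairwise.cons ?_ (List.pairwise_singleton _ _)
      intro y hy
      simp only [List.mem_cons, List.not_mem_nil, or_false] at hy
      subst hy
      refine ⟨9 * (m : ℤ) + (5 : ℕ), ⟨-3, by rw [sc_shift]; norm_num⟩, ?_⟩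
      rw [one_mul, abs_mul, abs_of_pos h2, zpow_add₀ (by norm_num : (2 : ℚ) ≠ 0), zpow_natCast,
        mul_comm]
      gcongr; norm_num
    · intro x hx y hy
      have hxm := abs_lt_of_mem_pairs3 m x hx
      simp only [sc_cons, sc_nil, List.mem_cons, List.not_mem_nil, or_false] at hy
      rcases hy with rfl | rfl
      · exact ⟨9 * (m : ℤ), ⟨5, by push_cast; ring⟩, by rwa [one_mul]⟩
      · exact ⟨9 * (m : ℤ), ⟨-96, by push_cast; ring⟩, by rwa [one_mul]⟩

/-- **`fam3 k` is a nonoverlapping expansion** (each component on a grid strictly above the lower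
ones). [cite: Shewchuk1997, §2.1 (nonoverlapping)] -/
theorem isExpansion_fam3 (k : ℕ) : IsExpansion 1 (fam3 k) := by
  have h2 : (0 : ℚ) < 2 ^ (9 * (k : ℤ)) := zpow_pos (by norm_num) _
  have hfam : fam3 k = pairs3 k ++ sc (9 * k) [-3, -24, 448, -20480] := by
    simp [fam3, state3, kink3, debris3]
  -- gaps inside the tail `⟨−3, −3·2^3, 7·2^6, −5·2^12⟩·2^(9k)`
  have gap : ∀ (a b : ℚ) (j : ℕ) (r : ℤ), b = r * 2 ^ j → |a| < 2 ^ j →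
      Below 1 (a * 2 ^ (9 * (k : ℤ))) (b * 2 ^ (9 * (k : ℤ))) := by
    intro a b j r hb ha
    refine ⟨9 * (k : ℤ) + j, ⟨r, by rw [sc_shift, hb]⟩, ?_⟩
    rw [one_mul, abs_mul, abs_of_pos h2, zpow_add₀ (by norm_num : (2 : ℚ) ≠ 0), zpow_natCast,
      mul_comm]
    gcongr
  rw [hfam, IsExpansion, List.pairwise_append]
  refine ⟨isExpansion_pairs3 k, ?_, ?_⟩
  · simp only [sc_cons, sc_nil]
    refine List.Pairwise.cons ?_ (List.Pairwise.cons ?_ (List.Pairwise.cons ?_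
      (List.pairwise_singleton _ _)))
    · intro y hy
      simp only [List.mem_cons, List.not_mem_nil, or_false] at hy
      rcases hy with rfl | rfl | rfl
      · exact gap (-3) (-24) 3 (-3) (by norm_num) (by norm_num)
      · exact gap (-3) 448 6 7 (by norm_num) (by norm_num)
      · exact gap (-3) (-20480) 12 (-5) (by norm_num) (by norm_num)
    · intro y hy
      simp only [List.mem_cons, List.not_mem_nil, or_false] at hy
      rcases hy with rfl | rfl
      · exact gap (-24) 448 6 7 (by norm_num) (by norm_num)
      · exact gap (-24) (-20480) 12 (-5) (by norm_num) (by norm_num)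
    · intro y hy
      simp only [List.mem_cons, List.not_mem_nil, or_false] at hy
      subst hy
      exact gap 448 (-20480) 12 (-5) (by norm_num) (by norm_num)
  · intro x hx y hy
    have hxk := abs_lt_of_mem_pairs3 k x hx
    simp only [sc_cons, sc_nil, List.mem_cons, List.not_mem_nil, or_false] at hy
    rcases hy with rfl | rfl | rfl | rfl
    · exact ⟨9 * (k : ℤ), ⟨-3, by push_cast; ring⟩, by rwa [one_mul]⟩
    · exact ⟨9 * (k : ℤ), ⟨-24, by push_cast; ring⟩, by rwa [one_mul]⟩
    · exact ⟨9 * (k : ℤ), ⟨448, by push_cast; ring⟩, by rwa [one_mul]⟩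
    · exact ⟨9 * (k : ℤ), ⟨-20480, by push_cast; ring⟩, by rwa [one_mul]⟩

/-- **The components of `fam3 k` are 3-bit floats** (`emin ≤ 0`). [cite: JeannerodRump2018, §1] -/
theorem isFloat_of_mem_fam3 (he : emin ≤ 0) (k : ℕ) : ∀ x ∈ fam3 k, IsFloat 3 emin x := by
  have hpairs : ∀ (m : ℕ) (x : ℚ), x ∈ pairs3 m → IsFloat 3 emin x := by
    intro m
    induction m with
    | zero => intro x hx; simp [pairs3] at hx
    | succ m ih =>
      intro x hx
      rw [pairs3, List.mem_append] at hx
      rcases hx with hx | hx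
      · exact ih x hx
      · have hs : (0 : ℤ) ≤ 9 * (m : ℕ) := by positivity
        simp only [sc_cons, sc_nil, List.mem_cons, List.not_mem_nil, or_false] at hx
        rcases hx with rfl | rfl
        · exact isFloat3_sc he hs 5 0 (by norm_num) (by norm_num)
        · exact isFloat3_sc he hs (-3) 5 (by norm_num) (by norm_num)
  have hfam : fam3 k = pairs3 k ++ sc (9 * k) [-3, -24, 448, -20480] := by
    simp [fam3, state3, kink3, debris3]
  have hs : (0 : ℤ) ≤ 9 * (k : ℕ) := by positivity
  rw [hfam]
  intro x hx
  rw [List.mem_append] at hx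
  rcases hx with hx | hx
  · exact hpairs k x hx
  · simp only [sc_cons, sc_nil, List.mem_cons, List.not_mem_nil, or_false] at hx
    rcases hx with rfl | rfl | rfl | rfl
    · exact isFloat3_sc he hs (-3) 0 (by norm_num) (by norm_num)
    · exact isFloat3_sc he hs (-3) 3 (by norm_num) (by norm_num)
    · exact isFloat3_sc he hs 7 6 (by norm_num) (by norm_num)
    · exact isFloat3_sc he hs (-5) 12 (by norm_num) (by norm_num)

/-- **COMPRESS PASS COUNTS ARE UNBOUNDED** (summary): for every `k`, `fam3 k` is a nonoverlapping
expansion of `2k + 4` three-bit floats on which COMPRESS (`p = 3`, ties-to-even, `emin ≤ 0`)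
changes its input in each of the first `k + 1` passes and is fixed afterwards.
[cite: Shewchuk1997, §2.7 p. 332 (COMPRESS)] -/
theorem compress_passes_unbounded (he : emin ≤ 0) (k : ℕ) :
    (fam3 k).length = 2 * k + 4 ∧ IsExpansion 1 (fam3 k) ∧ (∀ x ∈ fam3 k, IsFloat 3 emin x) ∧
      (∀ j ≤ k, (compress (roundTiesEven 3 emin))^[j + 1] (fam3 k) ≠
        (compress (roundTiesEven 3 emin))^[j] (fam3 k)) ∧
      (compress (roundTiesEven 3 emin))^[k + 2] (fam3 k) =
        (compress (roundTiesEven 3 emin))^[k + 1] (fam3 k) :=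
  ⟨length_fam3 k, isExpansion_fam3 k, isFloat_of_mem_fam3 he k,
    fun j hj => fam3_pass_changes he k j hj,
    by rw [(fam3_passes he k).2.2.1, (fam3_passes he k).2.1]⟩

end Summit.Ventures.CertifiedArithmetic.Expansions
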